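import Mathlib.Analysis.Calculus.InverseFunctionTheorem.ContDiff
import Mathlib.Analysis.Calculus.FDeriv.Mul
import Mathlib.Analysis.Calculus.FDeriv.Prod
import Mathlib.Analysis.Calculus.FDeriv.Pi
import Mathlib.Analysis.Calculus.ContDiff.Operations
import Mathlib.Analysis.Analytic.Polynomial
import Mathlib.Analysis.Analytic.Constructions
import Mathlib.Analysis.Complex.Basic
import Mathlib.Algebra.MvPolynomial.PDeriv
import Mathlib.LinearAlgebra.Matrix.Nondegenerate
import Mathlib.LinearAlgebra.FiniteDimensional.Lemmas
import Mathlib.Topology.Algebra.Module.FiniteDimension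
import HarnessLib

/-!
# The holomorphic implicit function theorem for polynomial equations

This file proves, from Mathlib's inverse function theorem, the piece of complex analysis used to
put a complex-manifold structure on the complex points of a smooth algebraic variety
(`Literature.NumberTheory.Transcendental.exists_algebraicChart`, `Literature.NumberTheory.Transcendental.exists_isAnalytification`; Serre, GAGA §2): the zero set
`Z = {F₁ = ⋯ = F_r = 0} ⊆ ℂ^ι` of complex polynomials whose Jacobian minor with respect to a set
`σ` of `r` of the variables is non-zero at a point `z₀ ∈ Z` is, near `z₀`, the graph of a
holomorphic map over an open subset of the space `ℂ^τ` of the remaining ("free") variables, so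
that the free coordinates are a holomorphic chart of `Z` at `z₀`
(`Literature.NumberTheory.Transcendental.exists_implicitChart`). In Serre's language: a point of an algebraic variety at which the
Jacobian criterion holds is a *simple point* of the associated analytic space, i.e. the analytic
space is there locally isomorphic to `ℂᵈ` [Serre, GAGA §1 n°4 and §2 n°6 Cor. 2]; classically this
is the holomorphic implicit function theorem [Gunning–Rossi, *Analytic functions of several
complex variables*, Ch. I §B Thm. 9; Griffiths–Harris, *Principles*, Ch. 0 §2].

## Main statements

* `Literature.NumberTheory.Transcendental.hasFDerivAt_eval`: the polynomial function `w ↦ p(w)` on `𝕜^ι` (`𝕜` a nontrivially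
  normed field, `ι` finite) has derivative `v ↦ ∑ᵢ (∂p/∂xᵢ)(z) vᵢ` at `z` — the bridge between
  Mathlib's algebraic partial derivatives `MvPolynomial.pderiv` and the Fréchet derivative.
* `Literature.NumberTheory.Transcendental.exists_implicitChart`: the implicit function chart described above.

## Proof

For `Literature.NumberTheory.Transcendental.exists_implicitChart` consider `G : ℂ^ι → ℂ^τ × ℂ^σ`, `G(z) = ((z_t)_{t ∈ τ}, F(z))`.
By `hasFDerivAt_eval` its derivative at `z₀` is `(π_τ, (∑ᵢ ∂ᵢF_j(z₀) vᵢ)_j)`, which is injective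
because the `σ × σ` minor `(∂F_j/∂x_{σ i})(z₀)` has non-zero determinant
(`Matrix.eq_zero_of_vecMul_eq_zero`), hence bijective by a dimension count; the inverse
function theorem (`ContDiffAt.toOpenPartialHomeomorph`, `ContDiffAt.to_localInverse` with
smoothness `ω`) makes `G` a local biholomorphism `Φ` at `z₀`, analytic inverse included on an
open set `N ∋ G(z₀)`. On `Ω = Φ.source ∩ G⁻¹(N)` the zero set is `G⁻¹(ℂ^τ × {0})`, the chart is
`z ↦ (z_t)_t` with inverse `ψ(w) = Φ⁻¹(w, 0)` defined on the open set `T = {w | (w, 0) ∈ N}`.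

## References

* J.-P. Serre, *Géométrie algébrique et géométrie analytique*, Ann. Inst. Fourier **6** (1956),
  §1 n°4, §2 n°5–6.
* R. C. Gunning, H. Rossi, *Analytic functions of several complex variables*, Prentice-Hall
  1965, Ch. I §B.
* P. Griffiths, J. Harris, *Principles of Algebraic Geometry*, Wiley 1978, Ch. 0 §2.
-/

noncomputable section

open MvPolynomial Topology Set
open scoped ContDiff Matrix

namespace Literature.NumberTheory.Transcendental

/-! ### The derivative of a polynomial function -/

section EvalDeriv

variable {𝕜 : Type*} [NontriviallyNormedField 𝕜] {ι : Type*} [Fintype ι]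

/-- **Polynomial functions are differentiable, with derivative given by the partial
derivatives**: for `p ∈ 𝕜[xᵢ : i ∈ ι]`, the function `w ↦ p(w)` on `𝕜^ι` has Fréchet derivative
`v ↦ ∑ᵢ (∂p/∂xᵢ)(z) vᵢ` at `z` (induction on `p`, Leibniz rule). Mathlib has analyticity of
polynomial functions (`AnalyticOnNhd.eval_mvPolynomial`) but not this formula.
[Gunning–Rossi Ch. I §A] [folklore] -/
theorem hasFDerivAt_eval (p : MvPolynomial ι 𝕜) (z : ι → 𝕜) :
    HasFDerivAt (fun w ↦ eval w p)
      (∑ i, eval z (pderiv i p) • (ContinuousLinearMap.proj i : (ι → 𝕜) →L[𝕜] 𝕜)) z := by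
  classical
  have happ : ∀ (q : MvPolynomial ι 𝕜) (v : ι → 𝕜),
      (∑ i, eval z (pderiv i q) • (ContinuousLinearMap.proj i : (ι → 𝕜) →L[𝕜] 𝕜)) v =
        ∑ i, eval z (pderiv i q) * v i := fun q v ↦ by
    simp
  induction p using MvPolynomial.induction_on with
  | C a =>
    have h0 : (∑ i, eval z (pderiv i (C a : MvPolynomial ι 𝕜)) •
        (ContinuousLinearMap.proj i : (ι → 𝕜) →L[𝕜] 𝕜)) = 0 := by
      ext v
      simp
    rw [h0]
    simp only [eval_C]
    exact hasFDerivAt_const a z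
  | add p q hp hq =>
    have hadd : (∑ i, eval z (pderiv i (p + q)) •
        (ContinuousLinearMap.proj i : (ι → 𝕜) →L[𝕜] 𝕜)) =
        (∑ i, eval z (pderiv i p) • (ContinuousLinearMap.proj i : (ι → 𝕜) →L[𝕜] 𝕜)) +
          ∑ i, eval z (pderiv i q) • (ContinuousLinearMap.proj i : (ι → 𝕜) →L[𝕜] 𝕜) := by
      ext v
      simp [happ, Finset.sum_add_distrib, add_mul]
    rw [hadd]
    simp only [map_add]
    exact hp.add hq
  | mul_X p i hp =>
    have hmul : (∑ k, eval z (pderiv k (p * X i)) •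
        (ContinuousLinearMap.proj k : (ι → 𝕜) →L[𝕜] 𝕜)) =
        eval z p • (ContinuousLinearMap.proj i : (ι → 𝕜) →L[𝕜] 𝕜) +
          z i • ∑ k, eval z (pderiv k p) • (ContinuousLinearMap.proj k : (ι → 𝕜) →L[𝕜] 𝕜) := by
      ext v
      rw [happ]
      simp only [add_apply, FunLike.coe_smul, Pi.smul_apply, ContinuousLinearMap.proj_apply,
        smul_eq_mul, Derivation.leibniz, pderiv_X, map_add, map_mul, eval_X, add_mul,
        Finset.sum_add_distrib, happ, Finset.mul_sum]
      congr 1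
      · rw [Finset.sum_eq_single i]
        · simp
        · intro k _ hk
          simp [Ne.symm hk]
        · simp
      · exact Finset.sum_congr rfl fun k _ ↦ by ring
    rw [hmul]
    simp only [map_mul, eval_X]
    exact hp.mul (hasFDerivAt_apply i z)

/-- Polynomial functions are `C^n` for every `n ≤ ω` (they are analytic,
`AnalyticOnNhd.eval_mvPolynomial`). [folklore] -/
theorem contDiffAt_eval [CompleteSpace 𝕜] (p : MvPolynomial ι 𝕜) (z : ι → 𝕜)
    {n : WithTop ℕ∞} : ContDiffAt 𝕜 n (fun w ↦ eval w p) z :=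
  ((AnalyticOnNhd.eval_mvPolynomial p) z (mem_univ z)).contDiffAt

end EvalDeriv

/-! ### The implicit function chart -/

section Implicit

variable {ι σ τ : Type*} [Fintype ι] [Fintype σ] [Fintype τ]

/-- **Holomorphic implicit function theorem for polynomial equations.** Let the coordinates of
`ℂ^ι` be split as `E : τ ⊕ σ ≃ ι`, let `F = (F_j)_{j ∈ σ}` be complex polynomials in the variables
`ι`, and let `z₀ ∈ ℂ^ι` be a point at which the Jacobian minor
`det ((∂F_j/∂x_{E(inr i)})(z₀))_{i j}` with respect to the `σ`-variables is non-zero. Then there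
are an open neighbourhood `Ω` of `z₀`, an open set `T ⊆ ℂ^τ` and a map `ψ : ℂ^τ → ℂ^ι`,
analytic at every point of `T`, such that the
projection `z ↦ (z_{E(inl t)})_t` to the free coordinates maps `{F = 0} ∩ Ω` bijectively onto `T`
with inverse `ψ`: for `z ∈ Ω` with `F(z) = 0` its projection lies in `T` and `ψ` of it is `z`;
for `w ∈ T`, `ψ(w) ∈ Ω`, `F(ψ(w)) = 0` and the projection of `ψ(w)` is `w`. (Near such a point the
zero set is a `#τ`-dimensional complex submanifold with the free coordinates as a chart: a
*simple point* in the sense of Serre.) [Serre, GAGA §1 n°4; Gunning–Rossi Ch. I §B Thm. 9]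
[folklore] -/
theorem exists_implicitChart [DecidableEq σ] (E : τ ⊕ σ ≃ ι) (F : σ → MvPolynomial ι ℂ)
    (z₀ : ι → ℂ)
    (hJ : (Matrix.of fun i j : σ ↦ eval z₀ (pderiv (E (Sum.inr i)) (F j))).det ≠ 0) :
    ∃ (Ω : Set (ι → ℂ)) (T : Set (τ → ℂ)) (ψ : (τ → ℂ) → (ι → ℂ)),
      IsOpen Ω ∧ z₀ ∈ Ω ∧ IsOpen T ∧ AnalyticOnNhd ℂ ψ T ∧
      (∀ z ∈ Ω, (∀ j, eval z (F j) = 0) →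
        (fun t ↦ z (E (Sum.inl t))) ∈ T ∧ ψ (fun t ↦ z (E (Sum.inl t))) = z) ∧
      (∀ w ∈ T, ψ w ∈ Ω ∧ (∀ j, eval (ψ w) (F j) = 0) ∧
        (fun t ↦ ψ w (E (Sum.inl t))) = w) := by
  classical
  -- the projection to the free coordinates and the map `G = (π, F)`
  let π : (ι → ℂ) →L[ℂ] (τ → ℂ) :=
    ContinuousLinearMap.pi fun t ↦ ContinuousLinearMap.proj (E (Sum.inl t))
  have hπ : ∀ z : ι → ℂ, π z = fun t ↦ z (E (Sum.inl t)) := fun z ↦ rfl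
  let G : (ι → ℂ) → (τ → ℂ) × (σ → ℂ) := fun z ↦ (π z, fun j ↦ eval z (F j))
  have hGzero : ∀ z : ι → ℂ, (∀ j, eval z (F j) = 0) →
      G z = ((fun t ↦ z (E (Sum.inl t))), 0) := fun z hz ↦
    Prod.ext (hπ z) (funext hz)
  -- its derivative at `z₀`
  let D : (ι → ℂ) →L[ℂ] (σ → ℂ) := ContinuousLinearMap.pi fun j ↦
    ∑ i, eval z₀ (pderiv i (F j)) • (ContinuousLinearMap.proj i : (ι → ℂ) →L[ℂ] ℂ)
  have hG : HasFDerivAt G (π.prod D) z₀ := by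
    refine π.hasFDerivAt.prodMk ?_
    exact hasFDerivAt_pi.mpr fun j ↦ by
      simpa [D] using hasFDerivAt_eval (F j) z₀
  -- the derivative is injective (the Jacobian minor is invertible) ...
  have hinj : Function.Injective (π.prod D) := by
    refine (injective_iff_map_eq_zero _).mpr fun v hv ↦ ?_
    have hv1 : ∀ t, v (E (Sum.inl t)) = 0 := fun t ↦ by
      have := congr_arg Prod.fst hv
      exact congr_fun this t
    have hv2 : ∀ j, ∑ i, eval z₀ (pderiv i (F j)) * v i = 0 := fun j ↦ by
      have := congr_fun (congr_arg Prod.snd hv) j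
      simpa [D] using this
    set u : σ → ℂ := fun i ↦ v (E (Sum.inr i)) with hu
    have huJ : u ᵥ* (Matrix.of fun i j : σ ↦ eval z₀ (pderiv (E (Sum.inr i)) (F j))) = 0 := by
      funext j
      rw [Matrix.vecMul, dotProduct]
      have h := hv2 j
      rw [← Equiv.sum_comp E, Fintype.sum_sum_type] at h
      simp only [hv1, mul_zero, Finset.sum_const_zero, zero_add] at h
      simpa [Matrix.of_apply, hu, mul_comm] using h
    have hu0 : u = 0 := Matrix.eq_zero_of_vecMul_eq_zero hJ huJ
    funext i
    obtain ⟨s, rfl⟩ := E.surjective i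
    rcases s with t | j
    · exact hv1 t
    · exact congr_fun hu0 j
  -- ... hence bijective, by a dimension count
  have hrank : Module.finrank ℂ (ι → ℂ) = Module.finrank ℂ ((τ → ℂ) × (σ → ℂ)) := by
    simp only [Module.finrank_prod, Module.finrank_fintype_fun_eq_card]
    rw [← Fintype.card_sum]
    exact Fintype.card_congr E.symm
  have hbij : Function.Bijective (π.prod D) :=
    ⟨hinj, (LinearMap.injective_iff_surjective_of_finrank_eq_finrank hrank
      (f := (π.prod D).toLinearMap)).mp hinj⟩
  let Geq : (ι → ℂ) ≃L[ℂ] ((τ → ℂ) × (σ → ℂ)) :=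
    (LinearEquiv.ofBijective (π.prod D).toLinearMap hbij).toContinuousLinearEquiv
  have hG' : HasFDerivAt G (Geq : (ι → ℂ) →L[ℂ] ((τ → ℂ) × (σ → ℂ))) z₀ := by
    convert hG using 1
    ext1 v
    simp [Geq]
  -- `G` is analytic
  have hGc : ContDiffAt ℂ ω G z₀ := by
    refine π.contDiff.contDiffAt.prodMk ?_
    exact contDiffAt_pi.mpr fun j ↦ contDiffAt_eval (F j) z₀
  have hn : (ω : WithTop ℕ∞) ≠ 0 := by simp
  -- the inverse function theorem
  let Φ := hGc.toOpenPartialHomeomorph G hG' hn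
  have hΦ : (Φ : (ι → ℂ) → (τ → ℂ) × (σ → ℂ)) = G := rfl
  have hz₀Φ : z₀ ∈ Φ.source := hGc.mem_toOpenPartialHomeomorph_source hG' hn
  have hsymm : ContDiffAt ℂ ω Φ.symm (G z₀) := hGc.to_localInverse hG' hn
  -- the open set where the local inverse is analytic
  let N : Set ((τ → ℂ) × (σ → ℂ)) := Φ.target ∩ {y | AnalyticAt ℂ Φ.symm y}
  have hN : IsOpen N := Φ.open_target.inter (isOpen_analyticAt ℂ Φ.symm)
  have hz₀N : G z₀ ∈ N := ⟨Φ.map_source hz₀Φ, hsymm.analyticAt⟩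
  let Ω : Set (ι → ℂ) := Φ.source ∩ G ⁻¹' N
  let emb : (τ → ℂ) → (τ → ℂ) × (σ → ℂ) := fun w ↦ (w, 0)
  have hemb : Continuous emb := continuous_id.prodMk continuous_const
  have hemb' : ∀ w, AnalyticAt ℂ emb w := fun w ↦ analyticAt_id.prod analyticAt_const
  let T : Set (τ → ℂ) := emb ⁻¹' N
  let ψ : (τ → ℂ) → (ι → ℂ) := fun w ↦ Φ.symm (emb w)
  refine ⟨Ω, T, ψ, Φ.isOpen_inter_preimage hN, ⟨hz₀Φ, hz₀N⟩, hN.preimage hemb,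
    fun w hw ↦ (hw.2).comp (hemb' w), fun z hz hFz ↦ ?_, fun w hw ↦ ?_⟩
  · have hGz : G z = emb (fun t ↦ z (E (Sum.inl t))) := hGzero z hFz
    refine ⟨?_, ?_⟩
    · change emb _ ∈ N
      rw [← hGz]
      exact hz.2
    · change Φ.symm (emb _) = z
      rw [← hGz, ← hΦ]
      exact Φ.left_inv hz.1
  · have hwt : emb w ∈ Φ.target := hw.1
    have hsrc : ψ w ∈ Φ.source := Φ.map_target hwt
    have hGψ : G (ψ w) = emb w := by
      rw [← hΦ]
      exact Φ.right_inv hwt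
    refine ⟨⟨hsrc, ?_⟩, fun j ↦ ?_, ?_⟩
    · change G (ψ w) ∈ N
      rw [hGψ]
      exact hw
    · have := congr_fun (congr_arg Prod.snd hGψ) j
      simpa [G, emb] using this
    · have := congr_arg Prod.fst hGψ
      simpa [G, emb, hπ] using this

end Implicit

end Literature.NumberTheory.Transcendental
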